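import Literature.Analysis.FluidPDE.LeiZhang2011RegularityLocal
import Literature.Analysis.FluidPDE.LeiZhang2011GaugeFix
import Literature.Analysis.FluidPDE.AxisymmetricL3SwirlTube
import Literature.Analysis.FluidPDE.AxisymmetricL3OffTube
import Literature.Analysis.FluidPDE.LeiZhang2011RegularityLerayHopf
import Literature.Analysis.FluidPDE.LerayLocalRegularH1Proofs
import Literature.Analysis.FluidPDE.TaoH1AlmostRegularAssembly
import Literature.Analysis.FluidPDE.NSLerayStrongLocalExistence
import Literature.Analysis.FluidPDE.CheskidovShvydkoyRegular
import HarnessLib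

/-!
# Lei–Zhang 2011, Theorem 1.4 — the discharge of `LeiZhang2011_regularity_bmoStream`

Analysis/FluidPDE **proofs file** (theorems only: no definitions, no named facts, no `sorry`)
closing the discharge path of `Literature.Analysis.FluidPDE.LeiZhang2011_regularity_bmoStream`
(Z. Lei, Q. S. Zhang, J. Funct. Anal. 261 (2011) = arXiv:1011.5066, **Theorem 1.4**: an
axisymmetric suitable Leray–Hopf weak solution on `ℝ³ × [0, T)` with `|r v₀^θ| ≤ C` and a stream
function with `BMO` slices bounded uniformly on `(0, T)` is smooth on `ℝ³ × (0, T]`).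

The printed proof (§4, pp. 12–13) argues by contradiction at a first singular time with a
blow-up sequence, using two facts about `Γ = r v^θ` and the velocity near the singular time:
`|Γ| ≤ C` ("by the assumption on initial value and the maximum principle") and, implicitly, that
the near-maxima concentrate at the axis. For a rough Leray–Hopf solution the tree replaces the
maximum principle by the **local maximum estimate of §2** (constant depending only on the `BMO`
bound): (H1) `Γ` is bounded in a tube around the axis near the singular time
(`AxisymmetricL3Hyp.swirl_bounded_tube`) — this needs no hypothesis on the initial swirl at all —
and supplies (H2) the boundedness of the velocity off the tube by partial regularity
(`AxisymmetricL3Hyp.bounded_offTube`: Caffarelli–Kohn–Nirenberg off the axis and at spatial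
infinity, for Leray–Hopf solutions classical below the singular time, with the associated Riesz
pressure). The blow-up argument under (H1)–(H2) is `LeiZhang2011_regularity_classical_local`,
with the swirl step (Theorem 1.2 of the paper for the gauge-fixed limit) `swirlStepU_holds`.

* `ae_bound_near_of_isH1RegularOn_local` — on an interval of `H¹`-regularity `(α, β)` of an
  axisymmetric Leray–Hopf solution with `BMO` stream slices, `u` is essentially bounded on
  `(β − δ, β) × ℝ³`: from good restart times the classical representative is packaged as
  standing hypotheses `AxisymmetricL3Hyp 1 (β − s') W P'`, and the local blow-up argument applies;
* `LeiZhang2011_regularity_lerayHopf_local` — hence (Leray's continuation,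
  Ladyzhenskaya–Prodi–Serrin) a classical representative on `(0, T]`;
* `LeiZhang2011_regularity_bmoStream_holds : LeiZhang2011_regularity_bmoStream` — **Theorem 1.4,
  proved** (the hypotheses of suitability and on the initial swirl are not used).

## References

* Z. Lei, Q. S. Zhang, J. Funct. Anal. 261 (2011) = arXiv:1011.5066: Thm. 1.4 (p. 4) and its
  proof §4 (pp. 12–13), §2 (2.6), Thm. 1.2. [LeiZhang2011]
* L. Caffarelli, R. Kohn, L. Nirenberg, Comm. Pure Appl. Math. 35 (1982). [CaffarelliKohnNirenberg1982]
* G. Koch, N. Nadirashvili, G. Seregin, V. Šverák, Acta Math. 203 (2009). [KochNadirashviliSereginSverak2009]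
-/

noncomputable section

open MeasureTheory Set Function Filter Topology TopologicalSpace Metric
open scoped InnerProductSpace RealInnerProductSpace NNReal ENNReal

namespace Literature.Analysis.FluidPDE

open Literature.Analysis.FunctionSpaces

/-- **The blow-up criterion on an interval of regularity, without a swirl bound.** Let `u` be
Leray–Hopf on `ℝ³ × [0, T)` (`ν = 1`) with axisymmetric slices and a stream function with `BMO`
slices on `(0, T)`, and assume the swirl step. If `u` is `H¹`-regular on `(α, β)`,
`0 ≤ α < β ≤ T`, then `u` is essentially bounded on `(β − δ, β) × ℝ³` for some `δ > 0`: from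
good restart times `s < s'` in `(α, β)` the classical representative `V` on `(s, β)`
(`exists_classical_Ioo_of_isH1RegularOn`), shifted to start at `s'` and glued with `u` at the top
time, satisfies the standing hypotheses `AxisymmetricL3Hyp 1 (β − s')` (Leray–Hopf by
`IsLerayHopfOn.congr_ae_slices`), so (H1) `AxisymmetricL3Hyp.swirl_bounded_tube`, (H2)
`AxisymmetricL3Hyp.bounded_offTube` and `LeiZhang2011_regularity_classical_local` bound it up to
`β`. [cite: LeiZhang2011, Thm. 1.4, proof §4 (arXiv pp. 12–13)] -/
theorem ae_bound_near_of_isH1RegularOn_local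
    (hstep : ∀ (v : ℝ → EuclideanSpace ℝ (Fin 3) → EuclideanSpace ℝ (Fin 3)) (C : ℝ)
      (K' : ℝ≥0),
      IsBoundedWeakNSSolutionOn (Iio 0) isOpen_Iio 1 v → Continuous (uncurry v) →
      (∀ t < 0, IsAxisymmetric (v t)) → (∀ t < 0, ∀ x, |swirl (v t) x| ≤ C) →
      (∀ t < 0, ∃ Bt : EuclideanSpace ℝ (Fin 3) → EuclideanSpace ℝ (Fin 3),
        LocallyIntegrable Bt volume ∧ eBMOSeminormVec Bt ≤ K' ∧
        ∀ (φ : EuclideanSpace ℝ (Fin 3) → ℝ) (e : EuclideanSpace ℝ (Fin 3)),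
          ContDiff ℝ 1 φ → HasCompactSupport φ →
            ∫ x, φ x * ⟪v t x, e⟫ = ∫ x, ⟪cross (Bt x) (gradient φ x), e⟫) →
      ∀ t < 0, HasNoSwirl (v t))
    {T : ℝ} {u₀ : EuclideanSpace ℝ (Fin 3) → EuclideanSpace ℝ (Fin 3)}
    {u : ℝ → EuclideanSpace ℝ (Fin 3) → EuclideanSpace ℝ (Fin 3)}
    (hLH : IsLerayHopfOn T 1 0 u₀ u) (haxi : ∀ t ∈ Ioo 0 T, IsAxisymmetric (u t))
    {Bs : ℝ → EuclideanSpace ℝ (Fin 3) → EuclideanSpace ℝ (Fin 3)} {Kb : ℝ≥0}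
    (hBs : HasBMOStreamFunctionOn (Ioo 0 T) u Bs Kb)
    {α β : ℝ} (hα : 0 ≤ α) (hαβ : α < β) (hβ : β ≤ T) (hreg : IsH1RegularOn (Ioo α β) u) :
    ∃ δ M : ℝ, 0 < δ ∧ ∀ t ∈ Ioo (β - δ) β, ∀ᵐ x ∂volume, ‖u t x‖ ≤ M := by
  -- a good time and the classical representative on `(s, β)`
  obtain ⟨s, hs, hLHs⟩ := hLH.exists_isLerayHopfOn_restart_Ioo zero_le_one hα hαβ hβ
  obtain ⟨V, P, hV, hrep⟩ := exists_classical_Ioo_of_isH1RegularOn one_pos hβ hreg hs hLHs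
  have h0s : 0 < s := hα.trans_lt hs.1
  have hmemT : ∀ t ∈ Ioo s β, t ∈ Ioo 0 T := fun t ht => ⟨h0s.trans ht.1, ht.2.trans_le hβ⟩
  have hVc : ∀ t ∈ Ioo s β, Continuous (V t) := fun t ht => (hV.contDiff_velocity ht).continuous
  have hVaxi : ∀ t ∈ Ioo s β, IsAxisymmetric (V t) := fun t ht =>
    (haxi t (hmemT t ht)).of_ae_eq (hrep t ht) (hVc t ht)
  have hVB : HasBMOStreamFunctionOn (Ioo s β) V Bs Kb :=
    (hBs.mono fun t ht => hmemT t ht).congr_ae hrep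
  have hVnorm : ∀ t ∈ Ioo s β, ∀ M : ℝ, (∀ᵐ x ∂volume, ‖u t x‖ ≤ M) → ∀ x, ‖V t x‖ ≤ M := by
    intro t ht M hM
    refine forall_norm_le_of_ae_bound (hVc t ht) ?_
    filter_upwards [hM, hrep t ht] with x hx hx'
    rwa [hx'] at hx
  -- a second good time `s' ∈ (s, β)`: Leray–Hopf from `u(s')`
  obtain ⟨s', hs', hLHs'⟩ := hLH.exists_isLerayHopfOn_restart_Ioo zero_le_one h0s.le hs.2 hβ
  set T' : ℝ := β - s' with hT'def
  have hT' : 0 < T' := sub_pos.2 hs'.2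
  have hLH1 : IsLerayHopfOn T' 1 0 (u s') (fun t => u (t + s')) := hLHs'.of_le (by linarith)
  have hmem' : ∀ t ∈ Ico 0 T', t + s' ∈ Ioo s β := fun t ht =>
    ⟨by linarith [ht.1, hs'.1], by linarith [ht.2]⟩
  -- the glued field: `V(· + s')` below the top time, `u(· + s')` from the top time on
  set W : ℝ → EuclideanSpace ℝ (Fin 3) → EuclideanSpace ℝ (Fin 3) :=
    fun t => if t < T' then V (t + s') else u (t + s') with hW
  have hWV : ∀ t, t < T' → W t = V (t + s') := fun t ht => by simp only [hW, if_pos ht]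
  have hWu : ∀ t, T' ≤ t → W t = u (t + s') := fun t ht => by simp only [hW, if_neg (not_lt.2 ht)]
  -- `W` is classical on `[0, T')`
  have hWcl : IsClassicalNSSolutionOn (Ico 0 T') 1 0 W (fun t => P (t + s')) := by
    have h := hV.comp_add_right s'
    have h0 : (fun t => (0 : ℝ → EuclideanSpace ℝ (Fin 3) → EuclideanSpace ℝ (Fin 3)) (t + s')) =
        0 := rfl
    rw [h0] at h
    have h1 : IsClassicalNSSolutionOn (Ico 0 T') 1 0 (fun t => V (t + s'))
        (fun t => P (t + s')) :=
      h.mono (fun t ht => show t + s' ∈ Ioo s β from hmem' t ht) (uniqueDiffOn_Ico _ _)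
    exact h1.congr_velocity fun t ht => hWV t ht.2
  -- `W` is Leray–Hopf on `[0, T')` from `W 0`
  have hWcont : ContinuousOn (uncurry W) (Ico 0 T' ×ˢ univ) := hWcl.smooth_velocity.continuousOn
  have hWm : AEStronglyMeasurable (uncurry W) (volume.restrict (Ioo 0 T' ×ˢ univ)) :=
    (hWcont.mono (prod_mono Ioo_subset_Ico_self Subset.rfl)).aestronglyMeasurable
      (measurableSet_Ioo.prod MeasurableSet.univ)
  have hWslices : ∀ t ∈ Icc 0 T', W t =ᵐ[volume] u (t + s') := by
    intro t ht
    rcases lt_or_ge t T' with hlt | hge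
    · rw [hWV t hlt]; exact (hrep (t + s') (hmem' t ⟨ht.1, hlt⟩)).symm
    · rw [hWu t hge]
  have hLHW' : IsLerayHopfOn T' 1 0 (u s') W := hLH1.congr_ae_slices hT' hWm hWslices
  have hW0 : W 0 =ᵐ[volume] u s' := by
    have := hWslices 0 ⟨le_rfl, hT'.le⟩
    simpa using this
  have hLHW : IsLerayHopfOn T' 1 0 (W 0) W := hLHW'.congr_datum_ae hW0
  -- bounds on the closed sub-slabs and axisymmetry
  have hWbdd : ∀ T'' < T', ∃ M : ℝ, ∀ t ∈ Icc 0 T'', ∀ x, ‖W t x‖ ≤ M := by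
    intro T'' hT''
    rcases lt_or_ge T'' 0 with hneg | hnn
    · exact ⟨0, fun t ht x => absurd (ht.1.trans ht.2) (not_le.2 hneg)⟩
    obtain ⟨M, hM⟩ := exists_ae_bound_Icc_of_isH1RegularOn one_pos hLH hα hβ hreg
      (a := s') (b := T'' + s') (hs.1.trans hs'.1) (by linarith)
    refine ⟨M, fun t ht x => ?_⟩
    have htT' : t < T' := ht.2.trans_lt hT''
    rw [hWV t htT']
    exact hVnorm _ (hmem' t ⟨ht.1, htT'⟩) M (hM (t + s') ⟨by linarith [ht.1], by linarith [ht.2]⟩) x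
  have hWaxi : ∀ t ∈ Ico 0 T', IsAxisymmetric (W t) := fun t ht => by
    rw [hWV t ht.2]; exact hVaxi _ (hmem' t ht)
  -- the standing hypotheses, the stream function, (H1) and (H2)
  have H : AxisymmetricL3Hyp 1 T' W (fun t => P (t + s')) :=
    ⟨one_pos, hT', hWcl, hLHW, hWbdd, hWaxi⟩
  have hWB : HasBMOStreamFunctionOn (Ioo 0 T') W (fun t => Bs (t + s')) Kb := fun t ht => by
    rw [hWV t ht.2]; exact hVB (t + s') (hmem' t (Ioo_subset_Ico_self ht))
  obtain ⟨T₁, hT₁, ρ, hρ, C₁, hC₁⟩ := H.swirl_bounded_tube hWB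
  obtain ⟨r₀, hr₀, M₀, hM₀⟩ := H.bounded_offTube (half_pos hρ)
  set T₂ : ℝ := max T₁ (T' - r₀ ^ 2) with hT₂
  have hT₂T : T₂ < T' := max_lt hT₁ (by nlinarith)
  have hH1 : ∃ C₁ : ℝ, ∀ t ∈ Ioo T₂ T', ∀ x, cylRadius x ≤ ρ → |swirl (W t) x| ≤ C₁ :=
    ⟨C₁, fun t ht x hx => hC₁ t ⟨(le_max_left _ _).trans_lt ht.1, ht.2⟩ x hx⟩
  have hH2 : ∃ M₀ : ℝ, ∀ t ∈ Ioo T₂ T', ∀ x, ρ / 2 ≤ cylRadius x → ‖W t x‖ ≤ M₀ :=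
    ⟨M₀, fun t ht x hx => hM₀ t ⟨(le_max_right _ _).trans_lt ht.1, ht.2⟩ x hx⟩
  -- the local blow-up argument
  obtain ⟨M, hM⟩ := LeiZhang2011_regularity_classical_local hstep hT' H.classical_Ioo
    (fun T'' hT'' => (hWbdd T'' hT'').imp fun M hM t ht x => hM t ⟨ht.1.le, ht.2.le⟩ x)
    (fun t ht => hWaxi t (Ioo_subset_Ico_self ht)) ⟨_, Kb, hWB⟩ hT₂T hρ hH1 hH2
  -- back to `u` on `(s', β)`
  refine ⟨T', M, hT', fun t ht => ?_⟩
  have h1 : t - s' ∈ Ioo 0 T' := ⟨by rw [hT'def] at ht; linarith [ht.1], by linarith [ht.2]⟩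
  have ht' : t ∈ Ioo s β := ⟨by linarith [h1.1, hs'.1], ht.2⟩
  have h2 := hM (t - s') h1
  rw [hWV _ h1.2] at h2
  simp only [sub_add_cancel] at h2
  filter_upwards [hrep t ht'] with x hx
  rw [hx]
  exact h2 x

/-- **Lei–Zhang 2011, Theorem 1.4 for Leray–Hopf weak solutions, without a swirl bound on the
slab (conditional only on the swirl step).** Let `u` be a Leray–Hopf weak solution of the
unforced Navier–Stokes system (`ν = 1`) on `ℝ³ × [0, T)` with axisymmetric slices and a stream
function with `BMO` slices on `(0, T)`. Then `u` has a classical representative on `(0, T]`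
(Leray's continuation theorem `leray_continuation_H1_holds` fed by
`ae_bound_near_of_isH1RegularOn_local`, then `classical_of_isH1RegularOn`).
[cite: LeiZhang2011, Thm. 1.4 and proof §4 (arXiv pp. 4, 12–13)] -/
theorem LeiZhang2011_regularity_lerayHopf_local
    (hstep : ∀ (v : ℝ → EuclideanSpace ℝ (Fin 3) → EuclideanSpace ℝ (Fin 3)) (C : ℝ)
      (K' : ℝ≥0),
      IsBoundedWeakNSSolutionOn (Iio 0) isOpen_Iio 1 v → Continuous (uncurry v) →
      (∀ t < 0, IsAxisymmetric (v t)) → (∀ t < 0, ∀ x, |swirl (v t) x| ≤ C) →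
      (∀ t < 0, ∃ Bt : EuclideanSpace ℝ (Fin 3) → EuclideanSpace ℝ (Fin 3),
        LocallyIntegrable Bt volume ∧ eBMOSeminormVec Bt ≤ K' ∧
        ∀ (φ : EuclideanSpace ℝ (Fin 3) → ℝ) (e : EuclideanSpace ℝ (Fin 3)),
          ContDiff ℝ 1 φ → HasCompactSupport φ →
            ∫ x, φ x * ⟪v t x, e⟫ = ∫ x, ⟪cross (Bt x) (gradient φ x), e⟫) →
      ∀ t < 0, HasNoSwirl (v t))
    {T : ℝ} {u₀ : EuclideanSpace ℝ (Fin 3) → EuclideanSpace ℝ (Fin 3)}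
    {u : ℝ → EuclideanSpace ℝ (Fin 3) → EuclideanSpace ℝ (Fin 3)} (hT : 0 < T)
    (hLH : IsLerayHopfOn T 1 0 u₀ u) (haxi : ∀ t ∈ Ioo 0 T, IsAxisymmetric (u t))
    (hB : ∃ (B : ℝ → EuclideanSpace ℝ (Fin 3) → EuclideanSpace ℝ (Fin 3)) (K : ℝ≥0),
      HasBMOStreamFunctionOn (Ioo 0 T) u B K) :
    ∃ (V : ℝ → EuclideanSpace ℝ (Fin 3) → EuclideanSpace ℝ (Fin 3))
      (P : ℝ → EuclideanSpace ℝ (Fin 3) → ℝ),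
      IsClassicalNSSolutionOn (Ioc 0 T) 1 0 V P ∧ ∀ t ∈ Ioc 0 T, u t =ᵐ[volume] V t := by
  obtain ⟨Bs, Kb, hBs⟩ := hB
  have hhyp : ∀ α β : ℝ, 0 ≤ α → α < β → β ≤ T → IsH1RegularOn (Ioo α β) u →
      limsup (fun t => eH1NormSq (u t)) (𝓝[<] β) < ⊤ := by
    intro α β hα hαβ hβ hreg
    obtain ⟨δ, M, hδ, hbd⟩ :=
      ae_bound_near_of_isH1RegularOn_local hstep hLH haxi hBs hα hαβ hβ hreg
    exact limsup_eH1NormSq_lt_top_of_ae_bound_near one_pos hLH hα hαβ hβ hreg hδ hbd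
  have hreg : IsH1RegularOn (Ioc 0 T) u := leray_continuation_H1_holds 1 T one_pos hT u₀ u hLH hhyp
  exact classical_of_isH1RegularOn ladyzhenskaya_prodi_serrin_holds one_pos hT hLH hreg

/-- **Lei–Zhang 2011, Theorem 1.4 — the named fact `LeiZhang2011_regularity_bmoStream`,
proved.** An axisymmetric Leray–Hopf weak solution `v` of the unforced Navier–Stokes system
(`ν = 1`) on `ℝ³ × [0, T)` from `v 0` with a stream function whose slices are in `BMO` with a
uniform bound on `(0, T)` is smooth on `ℝ³ × (0, T]`: there is `w`, smooth on `(0, T] × ℝ³`, with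
`v = w` a.e. on `(0, T) × ℝ³`. The proof is that of the paper (§4: contradiction at a first
singular time through the blow-up limits of Cases 1 and 2, the 2D Liouville theorem of KNSS and
Theorem 1.2 for the limit, here with the gauge-fixed stream function `swirlStepU_holds`), with
the printed bound on `Γ = r v^θ` "by the assumption on initial value and the maximum principle"
replaced by the local maximum estimate (2.6) of §2 near the singular time and the partial
regularity of axisymmetric suitable solutions off the axis and at spatial infinity; in particular
the hypotheses that `(v, p)` be suitable and that `|r v₀^θ| ≤ C` are not used.
[cite: LeiZhang2011, Thm. 1.4 (arXiv p. 4) and proof §4 (pp. 12–13); §2 (2.6); Thm. 1.2] -/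
theorem LeiZhang2011_regularity_bmoStream_holds : LeiZhang2011_regularity_bmoStream := by
  intro T hT v p _hsuit hLH haxi _hΓ₀ hB
  obtain ⟨V, P, hV, hrep⟩ := LeiZhang2011_regularity_lerayHopf_local swirlStepU_holds hT hLH haxi hB
  refine ⟨V, hV.smooth_velocity, ?_⟩
  refine uncurry_ae_eq_restrict_prod_of_forall_slice_ae_eq measurableSet_Ioo
    (fun t ht => hrep t ⟨ht.1, ht.2.le⟩) hLH.weak.1 ?_
  exact (hV.smooth_velocity.continuousOn.mono (prod_mono Ioo_subset_Ioc_self Subset.rfl)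
    ).aestronglyMeasurable (measurableSet_Ioo.prod MeasurableSet.univ)

end Literature.Analysis.FluidPDE
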